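import Summits.CriticalPhenomena.PercolationContinuityZ3.Theorems.PercNearOneGluingNoHeavyLowerTailCubicThreePointApexInduction
import HarnessLib

/-!
# `NoHeavyLowerTail` (stmt-CriticalPhenomena-4575) — splitting the step hypothesis at `b`, part 1: paths avoiding the apex, and Case A (apex–terminal edges) PROVED

Support file (prover prim-ineq-gen-2 gen 3, new-inequality factory; `--supports stmt-CriticalPhenomena-4575`).  Continues `…ApexInduction` (`GamW`, `PhiW`, `StepHypB`,
`gamma_of_stepHypB`) in prove-2's forced-edge calculus; no named facts, no sorries.
* Graph lemmas: `Rdel` (reachability avoiding the apex) is monotone in the forced set and the configuration; an open `b–c` connection whose cluster misses `a` avoids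
  the edges at `a` (`Rdel_of_R_of_not`, by `Walk.transfer`); an open `b–c` walk inside the support all of whose vertices avoid the cluster of `a` refutes `Sep` (`not_Sep_of_reach`).
* **Case A** of the step hypothesis: the peeled edge `e = {x,m}` has `x` forced-joined to `b` and `m` forced-joined to the apex `a` (an apex–terminal edge).  Then with `e` forced
  `a ~ b` (`caseA_ab`), `a ~ c ⟺ a ~ c ∨ b ~ c` before (`caseA_ac_iff`), the forced section has cells `W = N′ = u₂ = u₃ = 0`, `u₁¹ = q⁰+u₁⁰`, `n¹+m¹ = t⁰+u₂⁰+u₃⁰`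
  (`caseA_cells`) and `N¹ ⊆ N⁰ ∪ (ac|b)⁰` (`caseA_evN_subset`), so the chord defect is `Φ_e = u₃⁰·(u₂⁰ + n⁰ + n′⁰ − n¹) ≥ 0` (`caseA_phi`): apex–terminal edges satisfy the
  step hypothesis unconditionally (the census' 'ab-edge' class).
Part 2 (`…ApexCasesB`) does Case C (`b–c`-type edges = van den Berg–Häggström–Kahn) and isolates LEMMA B.  Memo: run/shared/lean/prim/prim-ineq-gen-2/HMAX-SPLIT.md.
[cite: GladkovZimin2024HK, §4 (forced edges / one-coordinate decomposition)]
-/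

noncomputable section

namespace Summit.CriticalPhenomena.PercolationContinuityZ3.Theorems

namespace CubicThreePointApex

open Finset SimpleGraph Literature.Probability.Percolation.DecisionTree CubicThreePointStep CubicThreePointTerminal

variable {V : Type*} [DecidableEq V]

/-! ### Graph lemmas: reachability avoiding the apex -/

/-- `Rdel` is monotone in the forced set. [folklore] -/
theorem Rdel_mono_insert {K S : Finset (Sym2 V)} (e : Sym2 V) {a x y : V} (h : Rdel K S a x y) :
    Rdel (insert e K) S a x y := by
  refine h.mono (fromEdgeSet_mono ?_)
  intro f hf
  refine ⟨?_, hf.2⟩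
  have : f ∈ S ∪ K := hf.1
  rw [Finset.mem_union] at this
  rw [Finset.mem_union, Finset.mem_insert]
  tauto

/-- `Rdel` is monotone in the configuration. [folklore] -/
theorem Rdel_mono_config {K S S' : Finset (Sym2 V)} (hS : S ⊆ S') {a x y : V} (h : Rdel K S a x y) :
    Rdel K S' a x y := by
  refine h.mono (fromEdgeSet_mono ?_)
  intro f hf
  refine ⟨?_, hf.2⟩
  have : f ∈ S ∪ K := hf.1
  rw [Finset.mem_union] at this ⊢
  rcases this with h1 | h1
  · exact Or.inl (hS h1)
  · exact Or.inr h1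

/-- A `b–c` connection in the open graph whose cluster misses `a` avoids the edges at `a`. [folklore] -/
theorem Rdel_of_R_of_not {K S : Finset (Sym2 V)} {a b c : V} (hbc : R K S b c) (hab : ¬ R K S a b) :
    Rdel K S a b c := by
  obtain ⟨w⟩ := hbc
  unfold Rdel
  refine ⟨w.transfer _ ?_⟩
  intro f hf
  have hfE : f ∈ (fromEdgeSet (↑(S ∪ K) : Set (Sym2 V))).edgeSet := w.edges_subset_edgeSet hf
  rw [edgeSet_fromEdgeSet] at hfE ⊢
  refine ⟨⟨?_, ?_⟩, hfE.2⟩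
  · exact_mod_cast hfE.1
  · intro ha
    -- `a` is a vertex of the walk, hence reachable from `b`
    induction f using Sym2.ind with
    | _ u v =>
      rcases Sym2.mem_iff.1 ha with rfl | rfl
      · exact hab ⟨(w.takeUntil _ (w.fst_mem_support_of_mem_edges hf)).reverse⟩
      · exact hab ⟨(w.takeUntil _ (w.snd_mem_support_of_mem_edges hf)).reverse⟩

/-- If `a` cannot separate: an open `b–c` walk all of whose vertices avoid the cluster of `a`, inside the support, refutes `Sep`. [folklore] -/
theorem not_Sep_of_reach {E K K' S : Finset (Sym2 V)} {a b c : V} (hbc : R K' S b c)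
    (hE : ∀ f, f ∈ S ∪ K' → f ∈ E) (hav : ∀ z, R K' S b z → ¬ R K S a z) : ¬ Sep E K S a b c := by
  obtain ⟨w⟩ := hbc
  intro hsep
  apply hsep
  refine ⟨w.transfer _ ?_⟩
  intro f hf
  have hfE : f ∈ (fromEdgeSet (↑(S ∪ K') : Set (Sym2 V))).edgeSet := w.edges_subset_edgeSet hf
  rw [edgeSet_fromEdgeSet] at hfE ⊢
  refine ⟨⟨hE f (by exact_mod_cast hfE.1), ?_⟩, hfE.2⟩
  intro z hz
  induction f using Sym2.ind with
  | _ u v =>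
    rcases Sym2.mem_iff.1 hz with rfl | rfl
    · exact hav _ ⟨w.takeUntil _ (w.fst_mem_support_of_mem_edges hf)⟩
    · exact hav _ ⟨w.takeUntil _ (w.snd_mem_support_of_mem_edges hf)⟩

/-! ### Case A: the edge joins `b`'s cluster to `a`'s cluster (`m` forced-joined to `a`) — the defect is `u₃(u₂ + n + n′ − N¹) ≥ 0` -/

section CaseA

variable {D K : Finset (Sym2 V)} {p : Sym2 V → ℝ} {a b c x m : V} (hxm : x ≠ m)
  (hbx : ∀ S : Finset (Sym2 V), R K S b x) (ham : ∀ S : Finset (Sym2 V), R K S a m)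
include hxm hbx ham

/-- With `e = {x,m}` forced, `a ~ b`. [folklore] -/
theorem caseA_ab (S : Finset (Sym2 V)) : R (insert s(x, m) K) S a b :=
  ((R_mono_insert _ (ham S)).trans (R_insert_edge hxm).symm).trans (R_mono_insert _ (hbx S)).symm

/-- With `e` forced, `a ~ c` iff `a ~ c` or `b ~ c` before. [folklore] -/
theorem caseA_ac_iff (S : Finset (Sym2 V)) : R (insert s(x, m) K) S a c ↔ R K S a c ∨ R K S b c := by
  constructor
  · intro h
    rcases reach_insert_cases h with h | ⟨h1, h2⟩ | ⟨h1, h2⟩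
    · exact Or.inl h
    · exact Or.inl ((ham S).trans h2)
    · exact Or.inr (((hbx S).trans h2))
  · rintro (h | h)
    · exact R_mono_insert _ h
    · exact (caseA_ab hxm hbx ham S).trans (R_mono_insert _ h)

/-- In Case A the forced section has `N¹ ⊆ N⁰ ∪ (ac|b)⁰`. [folklore] -/
theorem caseA_evN_subset (S : Finset (Sym2 V)) (hS : S ∈ evN (insert s(x, m) K) a b c) :
    S ∈ evN K a b c ∨ S ∈ evU₂ K a b c := by
  obtain ⟨_, hac1, hnd⟩ := hS
  by_cases hac : R K S a c
  · by_cases hab : R K S a b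
    · exact Or.inl ⟨hab, hac, fun hd => hnd (Rdel_mono_insert _ hd)⟩
    · exact Or.inr ⟨hac, hab⟩
  · exfalso
    have hbc : R K S b c := by
      rcases (caseA_ac_iff hxm hbx ham S).1 hac1 with h | h
      · exact absurd h hac
      · exact h
    have hab : ¬ R K S a b := fun h => hac (h.trans hbc)
    exact hnd (Rdel_mono_insert _ (Rdel_of_R_of_not hbc hab))

/-- Case A, the cells of the forced section: `W¹ = N′¹ = u₂¹ = u₃¹ = 0`, `u₁¹ = q⁰ + u₁⁰`, `n¹ + m¹ = t⁰ + u₂⁰ + u₃⁰`. [folklore] -/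
theorem caseA_cells (E : Finset (Sym2 V)) (D : Finset (Sym2 V)) (p : Sym2 V → ℝ) :
    PrW D p (evW E (insert s(x, m) K) a b c) = 0 ∧ PrW D p (evNp E (insert s(x, m) K) a b c) = 0 ∧
      PrW D p (evU₂ (insert s(x, m) K) a b c) = 0 ∧ PrW D p (evU₃ (insert s(x, m) K) a b c) = 0 ∧
      PrW D p (evU₁ (insert s(x, m) K) a b c) = PrW D p (evQ K a b c) + PrW D p (evU₁ K a b c) ∧
      PrW D p (evN (insert s(x, m) K) a b c) + PrW D p (evM (insert s(x, m) K) a b c) =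
        PrW D p (evT K a b c) + PrW D p (evU₂ K a b c) + PrW D p (evU₃ K a b c) := by
  have hab := caseA_ab hxm hbx ham
  refine ⟨PrW_eq_zero_of_forall D p (fun S _ h => h.1.1 (hab S)), PrW_eq_zero_of_forall D p (fun S _ h => h.1.1 (hab S)),
    PrW_eq_zero_of_forall D p (fun S _ (h : S ∈ evU₂ _ a b c) => h.2 (hab S)),
    PrW_eq_zero_of_forall D p (fun S _ (h : S ∈ evU₃ _ a b c) => h.2 (hab S)), ?_, ?_⟩
  · refine PrW_of_ind_add D p fun S _ => ?_
    have key : S ∈ evU₁ (insert s(x, m) K) a b c ↔ (S ∈ evQ K a b c ∨ S ∈ evU₁ K a b c) := by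
      rw [mem_evU₁, mem_evQ, mem_evU₁, caseA_ac_iff (c := c) hxm hbx ham S]
      constructor
      · rintro ⟨_, h⟩
        have h' := not_or.mp h
        by_cases hab' : R K S a b
        · exact Or.inr ⟨hab', h'.1⟩
        · exact Or.inl ⟨hab', h'.1, h'.2⟩
      · rintro (⟨h1, h2, h3⟩ | ⟨h1, h2⟩)
        · exact ⟨hab S, fun h => h.elim h2 h3⟩
        · exact ⟨hab S, fun h => h.elim h2 (fun hbc => h2 (h1.trans hbc))⟩
    by_cases h1 : S ∈ evU₁ (insert s(x, m) K) a b c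
    · rcases key.1 h1 with h | h
      · rw [ind_of_mem h1, ind_of_mem h, ind_of_not_mem (show S ∉ evU₁ K a b c from fun h' => h.1 h'.1)]; ring
      · rw [ind_of_mem h1, ind_of_mem h, ind_of_not_mem (show S ∉ evQ K a b c from fun h' => h'.1 h.1)]; ring
    · have h2 : S ∉ evQ K a b c := fun h => h1 (key.2 (Or.inl h))
      have h3 : S ∉ evU₁ K a b c := fun h => h1 (key.2 (Or.inr h))
      rw [ind_of_not_mem h1, ind_of_not_mem h2, ind_of_not_mem h3]; ring
  · rw [← PrW_evT]
    refine PrW_of_ind_add3 D p fun S _ => ?_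
    have key : S ∈ evT (insert s(x, m) K) a b c ↔ (S ∈ evT K a b c ∨ S ∈ evU₂ K a b c ∨ S ∈ evU₃ K a b c) := by
      rw [mem_evT, mem_evT, mem_evU₂, mem_evU₃, caseA_ac_iff (c := c) hxm hbx ham S]
      constructor
      · rintro ⟨_, h | h⟩
        · by_cases hab' : R K S a b
          · exact Or.inl ⟨hab', h⟩
          · exact Or.inr (Or.inl ⟨h, hab'⟩)
        · by_cases hab' : R K S a b
          · exact Or.inl ⟨hab', hab'.trans h⟩
          · exact Or.inr (Or.inr ⟨h, hab'⟩)
      · rintro (⟨h1, h2⟩ | ⟨h1, _⟩ | ⟨h1, _⟩)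
        · exact ⟨hab S, Or.inl h2⟩
        · exact ⟨hab S, Or.inl h1⟩
        · exact ⟨hab S, Or.inr h1⟩
    by_cases hT : S ∈ evT (insert s(x, m) K) a b c
    · rcases key.1 hT with h | h | h
      · rw [ind_of_mem hT, ind_of_mem h, ind_of_not_mem (show S ∉ evU₂ K a b c from fun h' => h'.2 h.1),
          ind_of_not_mem (show S ∉ evU₃ K a b c from fun h' => h'.2 h.1)]; ring
      · rw [ind_of_mem hT, ind_of_mem h, ind_of_not_mem (show S ∉ evT K a b c from fun h' => h.2 h'.1),
          ind_of_not_mem (show S ∉ evU₃ K a b c from fun h' => h'.2 ((h.1.trans h'.1.symm)))]; ring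
      · rw [ind_of_mem hT, ind_of_mem h, ind_of_not_mem (show S ∉ evT K a b c from fun h' => h.2 h'.1),
          ind_of_not_mem (show S ∉ evU₂ K a b c from fun h' => h.2 (h'.1.trans h.1.symm))]; ring
    · have h1 : S ∉ evT K a b c := fun h => hT (key.2 (Or.inl h))
      have h2 : S ∉ evU₂ K a b c := fun h => hT (key.2 (Or.inr (Or.inl h)))
      have h3 : S ∉ evU₃ K a b c := fun h => hT (key.2 (Or.inr (Or.inr h)))
      rw [ind_of_not_mem hT, ind_of_not_mem h1, ind_of_not_mem h2, ind_of_not_mem h3]; ring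

/-- **Case A** (`m` forced-joined to the apex `a`: an apex–terminal edge seen from `b`): the chord defect is
`u₃⁰·(u₂⁰ + n⁰ + n′⁰ − n¹) ≥ 0` since `N¹ ⊆ N⁰ ∪ (ac|b)⁰`. [folklore] -/
theorem caseA_phi (E : Finset (Sym2 V)) (D : Finset (Sym2 V)) {p : Sym2 V → ℝ} (hp0 : ∀ i, 0 ≤ p i) (hp1 : ∀ i, p i ≤ 1) :
    0 ≤ PhiW E D p K (insert s(x, m) K) a b c := by
  obtain ⟨cW, cNp, c2, c3, c1, cNM⟩ := caseA_cells hxm hbx ham E D p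
  have hN : PrW D p (evN (insert s(x, m) K) a b c) ≤ PrW D p (evN K a b c) + PrW D p (evU₂ K a b c) := by
    refine le_trans (PrW_mono D hp0 hp1 (fun S _ hS => ?_)) (PrW_union_le D hp0 hp1 (evN K a b c) (evU₂ K a b c))
    rcases caseA_evN_subset hxm hbx ham S hS with h | h
    · exact Or.inl h
    · exact Or.inr h
  have hM1 : PrW D p (evM (insert s(x, m) K) a b c) =
      PrW D p (evT K a b c) + PrW D p (evU₂ K a b c) + PrW D p (evU₃ K a b c) - PrW D p (evN (insert s(x, m) K) a b c) := by
    linarith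
  have hT0 := PrW_evT D p K a b c
  have h3 : 0 ≤ PrW D p (evU₃ K a b c) := PrW_nonneg D hp0 hp1 _
  have hNp : 0 ≤ PrW D p (evNp E K a b c) := PrW_nonneg D hp0 hp1 _
  have key : PhiW E D p K (insert s(x, m) K) a b c =
      PrW D p (evU₃ K a b c) * (PrW D p (evU₂ K a b c) + PrW D p (evN K a b c) + PrW D p (evNp E K a b c) -
        PrW D p (evN (insert s(x, m) K) a b c)) := by
    unfold PhiW GamW
    rw [cW, cNp, c2, c3, c1, hM1, hT0, PrW_evQ D p E K a b c]
    simp only [GamB, GamR]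
    ring
  rw [key]
  exact mul_nonneg h3 (by linarith)

end CaseA

end CubicThreePointApex

end Summit.CriticalPhenomena.PercolationContinuityZ3.Theorems
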